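import Summits.QuantumFields.BalabanUV.Beta.FP.ConstrainedGhostIRFinal
import Summits.QuantumFields.BalabanUV.Beta.FP.BlockAveragedKernelWindow

/-!
# `BalabanUV.Beta.FP.ConstrainedGhostIRWindow` — road «FP» for binder row D1, row H′2-IR ∕ IR-4a, channel (T2-win) (owner ruling R-FP-20 (c),
# R-FP-21 (A2)): THE WINDOW-SUMMED SECOND DIFFERENCES OF THE CONSTRAINED GHOST's WOODBURY REMAINDER ON `ℤ⁴`, LOG-FREE, UNCONDITIONALLY —
# `Σ_{‖q‖∞ ≤ N} |Δ_μΔ_ν ghostRem N (N•u + q, ·) x′| ≤ K_win` for ALL `N ≥ 1`, `μ, ν` (diagonal included), `u`, `x′`, `K_win` EXPLICIT and free of `N`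

HONEST DEPENDENCY (page 1, mandatory): continuum YM on T⁴ ⇐ BetaPertH ∧ nine spine estimates (0/9 proved); BetaPertH ⇐ (D1) ∧ (D4) ∧
CAP+tail; G-an2-4 gates asym, D1 and NE2/3/4.  HONEST FRAMING (cell contract, verbatim): «discharging `BetaPertH` makes Bałaban's UV
stability UNCONDITIONAL — a real constructive-QFT result; it is NOT the continuum limit and NOT the Clay problem.»  THIS MODULE is [folklore]
ℤ⁴ bookkeeping over tree theorems BY NAME: gan24-formalise-leaf-04's IR-1-ABS PART 4 (`BlockAveragedKernelScalar.blockAvg_eq_boxSum`), PART 5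
(`BlockAveragedKernelLegs.letterDiff_free`), PART 6 (`BlockAveragedKernelWindow`: summation by parts `blockSum_shift_sub_eq_sum_diffWeight`, the
difference weight's mass `sum_abs_blockDiffWeight_le`, the averaged (D2) `sum_box_abs_blockAvg_fwdDiff₂_le_window`), leaf-06's IR-4-IF
(`ConstrainedGhost.ghostRem_eq_tsum`, `ConstrainedGhostIR.abs_tsum_mul_le_of_profiles`) and IR-4b (`CoarseInverseScalar`), leaf-05-g9's IR-4a
(`ConstrainedGhostIRCoarse.abs_Ws_le_of_coarseInv`, `ConstrainedGhostIRLetters.letterOsc`, `ConstrainedGhostIRFinal.coarseInv_hC`); no `def`, no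
`def … : Prop`, nothing cited, 0 sorry.  WHAT IT IS: the (T2-win) channel of row H′2-IR's ghost letters — the radius-`N` window around ANY coarse point
carries a TOTAL second-difference mass `O(1)`, i.e. `O(N⁻⁴)` per position on average, with NO logarithm (the sup letter keeps its genuine block-edge
`log N`, owner (γ) l.21173; the window integrates it away, R-FP-20 (b)); a lemma toward `hbook`-MEAN of road FP; discharges NOTHING of `hasym`∕D1.
0∕4 binders of row D1; NOT D1, NOT BetaPertH, NOT continuum, NOT Clay.

ABSOLUTE RULE (cell charter, verbatim): «No internally-minted statement may enter as a cited fact. Every hypothesis is either kernel-proved in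
this package or a verbatim quotation of a PUBLISHED theorem with page reference. The manuscript(s) under audit are NOT citable for their own
disputed steps — they are the thing under adjudication; programme-internal (2001/route/tribunal) claims are never citable.»

CONTENT.  §1 `abs_blockAvg_fwdDiff_le_far`: FAR from the block, the first position-difference of the scalar block average of a degree-3 kernel
is `≤ (2∕n)·A∕(M+1)³` POINTWISE (PART 6's summation by parts puts the difference on the weight, mass `2∕n`; every kernel value is read at
distance `≥ M`).  §2 **`sum_box_abs_blockAvg_fwdDiff₂_le_profile`**: THE WINDOW (D2) WITH ITS COARSE PROFILE — from the first-difference letter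
`|P(z+e_μ) − P z| ≤ C₁∕(‖z‖∞+1)³` ALONE, for all `μ ν`, `N ≥ 1`, `u v`: `Σ_{q∈box 4 N}|Δ_νΔ_μF(N•u+q)| ≤ 82944·C₁∕(‖v−u‖∞+1)³`,
`F(x) = N⁻⁴·blockSum N (P(x−·)) v` (near `‖v−u‖∞ ≤ 3`: PART 6's window letter at radius `4N` re-anchored at the block; far: §1 × `(2N+1)⁴ ≤ 81N⁴`
positions).  §3 `sum_box_abs_secondDiff_ghostRem_le_of_letters`: a degree-3 window letter for the free-leg block columns ∧ the (W) letter (degree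
`b ≥ 2`) ⟹ `Σ_{q∈box 4 N}|Δ_eΔ_e′ ghostRem N (N•u+q,·) x′| ≤ 162·A_w·K·N⁻⁴` (Fubini `Summable.tsum_finsetSum` + `abs_tsum_mul_le_of_profiles`).
§4 `…_of_coarseInv` ((H-CINV) + (G1)) and **`sum_box_abs_secondDiff_ghostRem_le`** — UNCONDITIONAL, hypotheses `1 ≤ N` only, constant displayed.
Provenance: D1 formalisation swarm, unit b2b-balaban-beta-d1-formalise-leaf-05 gen 9 (prover-b2b-balaban-beta-d1-formalise-leaf-05-g9-0),
2026-08-20; `LEAVES-FP.md` row H′2-IR ∕ IR-4a (T2-win).  [folklore], 0 def, 0 cite, 0 sorry.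
-/

noncomputable section

namespace Summit.QuantumFields.BalabanUV.Beta.FP.ConstrainedGhostIRWindow

open Finset
open scoped BigOperators
open Literature.Probability.LatticeModels (latticeGreen box card_box)
open Literature.MathematicalPhysics.QuantumFieldTheory.Balaban1983to89
open B6QGQDecay237 (cInv deltaInv)
open B5Hk165ActionZd (actionKer)
open Literature.MathematicalPhysics.QuantumFieldTheory.Balaban1983to89.Beta
open AffineAveraging (toSite blockSum unitVec)
open Literature.MathematicalPhysics.QuantumFieldTheory.LatticeForm (quo)
open ScalarBlockKKT (Ws)
open Literature.MathematicalPhysics.QuantumFieldTheory.Balaban1983to89.Beta.DyadicShell (Pt supNorm mem_box_iff)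
open GradedBubbles (supNorm_neg)
open BlockLegs (supNorm_nsmul_real)
open Literature.MathematicalPhysics.QuantumFieldTheory.Balaban1983to89.Beta.TwoPowerLegs (free supNorm_unitVec)
open Literature.MathematicalPhysics.QuantumFieldTheory.Balaban1983to89.Beta.BubbleTransfer (c4)
open AxialBlockWeights (fineBlock)
open Summit.QuantumFields.BalabanUV.Beta.FP.BlockAveragedKernel (supNorm_add_le_nat supNorm_sub_le_nat supNorm_le_supNorm_sub_add letter_nonneg_of_le)
open Summit.QuantumFields.BalabanUV.Beta.FP.BlockAveragedKernelScalar (blockAvg_eq_boxSum)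
open Summit.QuantumFields.BalabanUV.Beta.FP.BlockAveragedKernelWindow (blockSum_shift_sub_eq_sum_diffWeight indicator_box_fineBlock
  sum_abs_blockDiffWeight_le sum_box_abs_blockAvg_fwdDiff₂_le_window blockSum_sub)
open Summit.QuantumFields.BalabanUV.Beta.FP.BlockAveragedKernelLegs (letterDiff_free)
open Summit.QuantumFields.BalabanUV.Beta.FP.ConstrainedGhost (ghostRem ghostRem_eq_tsum abs_blockSum_free_le summable_bdd_mul_Ws)
open Summit.QuantumFields.BalabanUV.Beta.FP.ConstrainedGhostIR (abs_tsum_mul_le_of_profiles)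
open Summit.QuantumFields.BalabanUV.Beta.FP.ConstrainedGhostIRCoarse (abs_Ws_le_of_coarseInv)
open Summit.QuantumFields.BalabanUV.Beta.FP.ConstrainedGhostIRLetters (letterOsc)
open Summit.QuantumFields.BalabanUV.Beta.FP.ConstrainedGhostIRFinal (coarseInv_hC)
open Summit.QuantumFields.BalabanUV.Beta.FP.CoarseInverseScalar (hasSum_coarseInv_mul_bracket')

variable {N : ℕ} [NeZero N]

/-! ## §1 Far from the block: the first position-difference of a degree-3 block average, pointwise, by summation by parts -/

omit [NeZero N] in
/-- [folklore] **FAR-REGION POINTWISE FIRST DIFFERENCE.**  `|Q z| ≤ A∕(‖z‖∞+1)³`, `n ≥ 1`, and the position `x` at sup-distance `≥ n + 2 + M` from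
the block anchor `n•v`: `|F_Q(x + e_ν) − F_Q(x)| ≤ (2∕n)·A∕(M+1)³`, `F_Q(x) = n⁻⁴·blockSum n (Q(x − ·)) v` — PART 6's summation by parts moves the
difference onto the flat weight (mass `2∕n`, `sum_abs_blockDiffWeight_le`), and every kernel value is then read at sup-distance `≥ M`. -/
theorem abs_blockAvg_fwdDiff_le_far {Q : Pt → ℝ} {A : ℝ} (hQ : ∀ z, |Q z| ≤ A / ((supNorm z : ℝ) + 1) ^ 3)
    {n : ℕ} (hn : 1 ≤ n) (ν : Fin 4) (v x : Pt) {M : ℕ} (hfar : n + 2 + M ≤ supNorm (x - n • v)) :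
    |((n : ℝ) ^ 4)⁻¹ * blockSum n (fun y => Q (x + Pi.single ν 1 - y)) v - ((n : ℝ) ^ 4)⁻¹ * blockSum n (fun y => Q (x - y)) v|
      ≤ 2 / (n : ℝ) * (A / ((M : ℝ) + 1) ^ 3) := by
  have hA := letter_nonneg_of_le hQ
  have he1 : supNorm (Pi.single ν 1 : Pt) = 1 := by
    rw [show (Pi.single ν 1 : Pt) = BubbleTransfer.unitVec ν from rfl, supNorm_unitVec]
  have he : supNorm (Pi.single ν 1 : Pt) ≤ 1 := he1.le
  -- summation by parts (PART 6 §2): the difference sits on the weight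
  have hp : ((n : ℝ) ^ 4)⁻¹ * blockSum n (fun y => Q (x + Pi.single ν 1 - y)) v - ((n : ℝ) ^ 4)⁻¹ * blockSum n (fun y => Q (x - y)) v
      = ∑ s ∈ box 4 (n + 1), ((if s ∈ fineBlock n then ((n : ℝ) ^ 4)⁻¹ else 0)
          - (if s - Pi.single ν 1 ∈ fineBlock n then ((n : ℝ) ^ 4)⁻¹ else 0)) * Q ((x - n • v) + Pi.single ν 1 - s) := by
    rw [blockAvg_eq_boxSum, blockAvg_eq_boxSum]
    have e1 : ∀ m ∈ box 4 n, (if m ∈ fineBlock n then ((n : ℝ) ^ 4)⁻¹ else 0) * Q (x + Pi.single ν 1 - (n • v + m))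
        = (if m ∈ fineBlock n then ((n : ℝ) ^ 4)⁻¹ else 0) * Q ((x - n • v) + Pi.single ν 1 - m) := by
      intro m _; congr 2; abel
    have e2 : ∀ m ∈ box 4 n, (if m ∈ fineBlock n then ((n : ℝ) ^ 4)⁻¹ else 0) * Q (x - (n • v + m))
        = (if m ∈ fineBlock n then ((n : ℝ) ^ 4)⁻¹ else 0) * Q ((x - n • v) - m) := by
      intro m _; congr 2; abel
    rw [sum_congr rfl e1, sum_congr rfl e2,
      blockSum_shift_sub_eq_sum_diffWeight (fun m => if m ∈ fineBlock n then ((n : ℝ) ^ 4)⁻¹ else 0) Q n (x - n • v) (Pi.single ν 1) he]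
    refine sum_congr rfl fun s _ => ?_
    rw [indicator_box_fineBlock, indicator_box_fineBlock]
  rw [hp]
  -- every kernel value on the enlarged box is read at sup-distance `≥ M`
  have hQfar : ∀ s ∈ box 4 (n + 1), |Q ((x - n • v) + Pi.single ν 1 - s)| ≤ A / ((M : ℝ) + 1) ^ 3 := by
    intro s hs
    rw [mem_box_iff] at hs
    have h1 : supNorm (x - n • v) ≤ supNorm ((x - n • v) + Pi.single ν 1) + supNorm (Pi.single ν 1 : Pt) := by
      have h := supNorm_sub_le_nat ((x - n • v) + Pi.single ν 1) (Pi.single ν 1)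
      rwa [add_sub_cancel_right] at h
    have h2 := supNorm_le_supNorm_sub_add ((x - n • v) + Pi.single ν 1) s
    have hM : M ≤ supNorm ((x - n • v) + Pi.single ν 1 - s) := by rw [he1] at h1; omega
    have hMr : (M : ℝ) ≤ (supNorm ((x - n • v) + Pi.single ν 1 - s) : ℝ) := by exact_mod_cast hM
    have hM' : ((M : ℝ) + 1) ^ 3 ≤ ((supNorm ((x - n • v) + Pi.single ν 1 - s) : ℝ) + 1) ^ 3 := by gcongr
    exact (hQ _).trans (div_le_div_of_nonneg_left hA (by positivity) hM')
  calc |∑ s ∈ box 4 (n + 1), ((if s ∈ fineBlock n then ((n : ℝ) ^ 4)⁻¹ else 0)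
          - (if s - Pi.single ν 1 ∈ fineBlock n then ((n : ℝ) ^ 4)⁻¹ else 0)) * Q ((x - n • v) + Pi.single ν 1 - s)|
      ≤ ∑ s ∈ box 4 (n + 1), |(if s ∈ fineBlock n then ((n : ℝ) ^ 4)⁻¹ else 0)
          - (if s - Pi.single ν 1 ∈ fineBlock n then ((n : ℝ) ^ 4)⁻¹ else 0)| * (A / ((M : ℝ) + 1) ^ 3) := by
        refine (abs_sum_le_sum_abs _ _).trans (sum_le_sum fun s hs => ?_)
        rw [abs_mul]
        exact mul_le_mul_of_nonneg_left (hQfar s hs) (abs_nonneg _)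
    _ = (∑ s ∈ box 4 (n + 1), |(if s ∈ fineBlock n then ((n : ℝ) ^ 4)⁻¹ else 0)
          - (if s - Pi.single ν 1 ∈ fineBlock n then ((n : ℝ) ^ 4)⁻¹ else 0)|) * (A / ((M : ℝ) + 1) ^ 3) := by rw [sum_mul]
    _ ≤ 2 / (n : ℝ) * (A / ((M : ℝ) + 1) ^ 3) :=
        mul_le_mul_of_nonneg_right (sum_abs_blockDiffWeight_le hn ν) (by positivity)

/-! ## §2 The window (D2) with its coarse profile -/

omit [NeZero N] in
/-- [folklore] **THE WINDOW-SUMMED SECOND DIFFERENCES WITH THEIR COARSE PROFILE, NO LOGARITHM** (all `μ, ν`, the diagonal included).  With the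
first-difference letter `|P(z + e_μ) − P z| ≤ C₁∕(‖z‖∞+1)³` ALONE, `N ≥ 1`, all `u v : ℤ⁴`, writing `F(x) := N⁻⁴·blockSum N (y ↦ P(x − y)) v`:
`Σ_{q ∈ box 4 N} |F(N•u+q+e_ν+e_μ) − F(N•u+q+e_ν) − F(N•u+q+e_μ) + F(N•u+q)| ≤ 82944·C₁∕(‖v − u‖∞ + 1)³`.
Near (`‖v−u‖∞ ≤ 3`): the radius-`N` window at `N•u` sits inside the radius-`4N` window at the block anchor `N•v`, where PART 6's
`sum_box_abs_blockAvg_fwdDiff₂_le_window` gives `≤ 162·C₁·(5N+3)∕N ≤ 1296·C₁`; far (`‖v−u‖∞ ≥ 4`): §1 with `Q := Δ_μP` at `M + 1 = N(‖v−u‖∞ − 3)`,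
pointwise `≤ 250·C₁·N⁻⁴∕(‖v−u‖∞+1)³`, times `(2N+1)⁴ ≤ 81N⁴` positions. -/
theorem sum_box_abs_blockAvg_fwdDiff₂_le_profile {P : Pt → ℝ} {C₁ : ℝ} (μ ν : Fin 4)
    (hΔ : ∀ z, |P (z + Pi.single μ 1) - P z| ≤ C₁ / ((supNorm z : ℝ) + 1) ^ 3) (hN : 1 ≤ N) (u v : Pt) :
    ∑ q ∈ box 4 N, |((N : ℝ) ^ 4)⁻¹ * blockSum N (fun y => P (N • u + q + Pi.single ν 1 + Pi.single μ 1 - y)) v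
        - ((N : ℝ) ^ 4)⁻¹ * blockSum N (fun y => P (N • u + q + Pi.single ν 1 - y)) v
        - ((N : ℝ) ^ 4)⁻¹ * blockSum N (fun y => P (N • u + q + Pi.single μ 1 - y)) v
        + ((N : ℝ) ^ 4)⁻¹ * blockSum N (fun y => P (N • u + q - y)) v|
      ≤ 82944 * C₁ / ((supNorm (v - u) : ℝ) + 1) ^ 3 := by
  have hC : 0 ≤ C₁ := letter_nonneg_of_le (K := fun z => P (z + Pi.single μ 1) - P z) hΔ
  have hN0 : (0 : ℝ) < N := by exact_mod_cast hN
  have hN1 : (1 : ℝ) ≤ N := by exact_mod_cast hN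
  -- the second difference as a function of the position
  set f : Pt → ℝ := fun x => |((N : ℝ) ^ 4)⁻¹ * blockSum N (fun y => P (x + Pi.single ν 1 + Pi.single μ 1 - y)) v
        - ((N : ℝ) ^ 4)⁻¹ * blockSum N (fun y => P (x + Pi.single ν 1 - y)) v
        - ((N : ℝ) ^ 4)⁻¹ * blockSum N (fun y => P (x + Pi.single μ 1 - y)) v
        + ((N : ℝ) ^ 4)⁻¹ * blockSum N (fun y => P (x - y)) v| with hf
  have hf0 : ∀ x, 0 ≤ f x := fun x => abs_nonneg _
  change ∑ q ∈ box 4 N, f (N • u + q) ≤ _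
  have hd : supNorm (u - v) = supNorm (v - u) := by rw [← supNorm_neg, neg_sub]
  have hsmul : supNorm (N • (u - v)) = N * supNorm (u - v) := by exact_mod_cast supNorm_nsmul_real N (u - v)
  rcases le_or_gt (supNorm (v - u)) 3 with hnear | hfar
  · -- NEAR: re-anchor the window at the block
    have hinj : Set.InjOn (fun q : Pt => N • (u - v) + q) (box 4 N : Set Pt) := fun a _ b _ h => by simpa using h
    have hsub : (box 4 N).image (fun q : Pt => N • (u - v) + q) ⊆ box 4 (4 * N) := by
      intro p hp
      obtain ⟨q, hq, rfl⟩ := mem_image.mp hp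
      rw [mem_box_iff] at hq ⊢
      have h1 := supNorm_add_le_nat (N • (u - v)) q
      have h3 : N * supNorm (u - v) ≤ N * 3 := Nat.mul_le_mul_left N (hd ▸ hnear)
      omega
    have hreindex : ∑ q ∈ box 4 N, f (N • u + q) = ∑ p ∈ (box 4 N).image (fun q : Pt => N • (u - v) + q), f (N • v + p) := by
      rw [sum_image (fun a ha b hb h => hinj ha hb h)]
      refine sum_congr rfl fun q _ => ?_
      congr 1
      rw [smul_sub]; abel
    have hwin := sum_box_abs_blockAvg_fwdDiff₂_le_window μ ν hΔ hN v (4 * N)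
    have hvol : 162 * C₁ * ((((4 * N + (N + 1) + 1 : ℕ) : ℝ)) + 1) / N ≤ 1296 * C₁ := by
      rw [div_le_iff₀ hN0]; push_cast; nlinarith
    have hprof : (1296 : ℝ) * C₁ ≤ 82944 * C₁ / ((supNorm (v - u) : ℝ) + 1) ^ 3 := by
      rw [le_div_iff₀ (by positivity)]
      have h3 : (supNorm (v - u) : ℝ) ≤ 3 := by exact_mod_cast hnear
      have h64 : ((supNorm (v - u) : ℝ) + 1) ^ 3 ≤ (4 : ℝ) ^ 3 := pow_le_pow_left₀ (by positivity) (by linarith) 3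
      calc 1296 * C₁ * ((supNorm (v - u) : ℝ) + 1) ^ 3 ≤ 1296 * C₁ * (4 : ℝ) ^ 3 := mul_le_mul_of_nonneg_left h64 (by positivity)
        _ = 82944 * C₁ := by norm_num; ring
    calc ∑ q ∈ box 4 N, f (N • u + q) = ∑ p ∈ (box 4 N).image (fun q : Pt => N • (u - v) + q), f (N • v + p) := hreindex
      _ ≤ ∑ p ∈ box 4 (4 * N), f (N • v + p) := sum_le_sum_of_subset_of_nonneg hsub fun _ _ _ => hf0 _
      _ ≤ 162 * C₁ * ((((4 * N + (N + 1) + 1 : ℕ) : ℝ)) + 1) / N := hwin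
      _ ≤ 82944 * C₁ / ((supNorm (v - u) : ℝ) + 1) ^ 3 := hvol.trans hprof
  · -- FAR: pointwise by §1 with `Q := Δ_μ P`, then count the `(2N+1)⁴ ≤ 81N⁴` positions
    set d : ℕ := supNorm (v - u) with hdd
    have hd4 : 4 ≤ d := hfar
    -- the product `N·d` as an opaque natural with its two linear facts
    set K : ℕ := N * d with hK
    have hK4 : 4 * N ≤ K := by rw [hK]; nlinarith
    have hKd : supNorm (N • (u - v)) = K := by rw [hsmul, hd]
    have hpt : ∀ q ∈ box 4 N, f (N • u + q) ≤ 250 * C₁ / ((N : ℝ) ^ 4 * ((d : ℝ) + 1) ^ 3) := by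
      intro q hq
      rw [mem_box_iff] at hq
      -- `F(· + e_μ) − F(·)` is the block average of `Q := Δ_μ P`
      have e : ∀ y : Pt, ((N : ℝ) ^ 4)⁻¹ * blockSum N (fun y' => P (y - y' + Pi.single μ 1) - P (y - y')) v
          = ((N : ℝ) ^ 4)⁻¹ * blockSum N (fun y' => P (y + Pi.single μ 1 - y')) v - ((N : ℝ) ^ 4)⁻¹ * blockSum N (fun y' => P (y - y')) v := by
        intro y
        rw [blockSum_sub, mul_sub]
        have e1 : blockSum N (fun y' => P (y - y' + Pi.single μ 1)) v = blockSum N (fun y' => P (y + Pi.single μ 1 - y')) v := by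
          unfold blockSum; exact sum_congr rfl fun b _ => congrArg P (by abel)
        rw [e1]
      have hM : N + 2 + (K - 3 * N - 1) ≤ supNorm (N • u + q - N • v) := by
        have h1 : supNorm (N • (u - v)) ≤ supNorm (N • (u - v) + q) + supNorm q := by
          have h := supNorm_sub_le_nat (N • (u - v) + q) q
          rwa [add_sub_cancel_right] at h
        have e2 : N • u + q - N • v = N • (u - v) + q := by rw [smul_sub]; abel
        rw [e2]; omega
      have h := abs_blockAvg_fwdDiff_le_far (Q := fun z => P (z + Pi.single μ 1) - P z) hΔ hN ν v (N • u + q) hM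
      rw [e, e] at h
      have eM : (((K - 3 * N - 1 : ℕ) : ℝ) + 1) = (N : ℝ) * ((d : ℝ) - 3) := by
        rw [Nat.cast_sub (by omega : 1 ≤ K - 3 * N), Nat.cast_sub (by omega : 3 * N ≤ K)]
        push_cast
        rw [hK]; push_cast; ring
      have hd4' : (4 : ℝ) ≤ d := by exact_mod_cast hd4
      have hden : (N : ℝ) ^ 4 * ((d : ℝ) + 1) ^ 3 ≤ 125 * ((N : ℝ) * ((N : ℝ) * ((d : ℝ) - 3)) ^ 3) := by
        have h5 : (d : ℝ) + 1 ≤ 5 * ((d : ℝ) - 3) := by linarith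
        have h0 : 0 ≤ (d : ℝ) + 1 := by positivity
        calc (N : ℝ) ^ 4 * ((d : ℝ) + 1) ^ 3 ≤ (N : ℝ) ^ 4 * (5 * ((d : ℝ) - 3)) ^ 3 := by gcongr
          _ = 125 * ((N : ℝ) * ((N : ℝ) * ((d : ℝ) - 3)) ^ 3) := by ring
      have hpos : 0 < (N : ℝ) * ((N : ℝ) * ((d : ℝ) - 3)) ^ 3 := by
        have : 0 < (d : ℝ) - 3 := by linarith
        positivity
      calc f (N • u + q)
          = |((N : ℝ) ^ 4)⁻¹ * blockSum N (fun y => P (N • u + q + Pi.single ν 1 + Pi.single μ 1 - y)) v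
              - ((N : ℝ) ^ 4)⁻¹ * blockSum N (fun y => P (N • u + q + Pi.single ν 1 - y)) v
              - (((N : ℝ) ^ 4)⁻¹ * blockSum N (fun y => P (N • u + q + Pi.single μ 1 - y)) v
                - ((N : ℝ) ^ 4)⁻¹ * blockSum N (fun y => P (N • u + q - y)) v)| := by rw [hf]; ring_nf
        _ ≤ 2 / (N : ℝ) * (C₁ / ((((K - 3 * N - 1 : ℕ) : ℝ)) + 1) ^ 3) := h
        _ = 2 * C₁ / ((N : ℝ) * ((N : ℝ) * ((d : ℝ) - 3)) ^ 3) := by rw [eM]; field_simp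
        _ ≤ 250 * C₁ / ((N : ℝ) ^ 4 * ((d : ℝ) + 1) ^ 3) := by
            rw [div_le_div_iff₀ hpos (by positivity)]
            calc 2 * C₁ * ((N : ℝ) ^ 4 * ((d : ℝ) + 1) ^ 3) ≤ 2 * C₁ * (125 * ((N : ℝ) * ((N : ℝ) * ((d : ℝ) - 3)) ^ 3)) :=
                  mul_le_mul_of_nonneg_left hden (by positivity)
              _ = 250 * C₁ * ((N : ℝ) * ((N : ℝ) * ((d : ℝ) - 3)) ^ 3) := by ring
    have hcard : ((box 4 N).card : ℝ) ≤ 81 * (N : ℝ) ^ 4 := by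
      rw [card_box]; push_cast; nlinarith [pow_le_pow_left₀ (by positivity : (0:ℝ) ≤ 2 * N + 1) (by linarith : (2 : ℝ) * N + 1 ≤ 3 * N) 4]
    calc ∑ q ∈ box 4 N, f (N • u + q) ≤ ∑ _q ∈ box 4 N, 250 * C₁ / ((N : ℝ) ^ 4 * ((d : ℝ) + 1) ^ 3) := sum_le_sum hpt
      _ = (box 4 N).card * (250 * C₁ / ((N : ℝ) ^ 4 * ((d : ℝ) + 1) ^ 3)) := by rw [sum_const, nsmul_eq_mul]
      _ ≤ 81 * (N : ℝ) ^ 4 * (250 * C₁ / ((N : ℝ) ^ 4 * ((d : ℝ) + 1) ^ 3)) := mul_le_mul_of_nonneg_right hcard (by positivity)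
      _ = 20250 * C₁ / ((d : ℝ) + 1) ^ 3 := by field_simp; ring
      _ ≤ 82944 * C₁ / ((d : ℝ) + 1) ^ 3 := by gcongr; norm_num

/-! ## §3 Composition: window letter for the free-leg block columns ∧ (W) letter ⟹ the window-summed second differences of `ghostRem` -/

/-- [folklore] **(T2-win) FROM TWO LETTERS.**  If the window-summed second `(e,e′)`-differences of the free-leg block columns
`S(x,y) = blockSum N (G₀(x−·)) y` over the radius-`N` window at `N•u` carry the degree-3 coarse profile `A_w·(‖y−u‖∞+1)⁻³`, and the multiplier has the
(W) letter `|Ws(y,x′)| ≤ K·N⁻⁴·(‖y − quo N x′‖∞+1)^{−b}`, `b ≥ 2`, then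
`Σ_{q∈box 4 N} |ghostRem N (N•u+q+e+e′) x′ − ghostRem N (N•u+q+e) x′ − ghostRem N (N•u+q+e′) x′ + ghostRem N (N•u+q) x′| ≤ 162·A_w·K·N⁻⁴`
(`ghostRem_eq_tsum`, Fubini for a finite window `Summable.tsum_finsetSum`, leaf-06's `abs_tsum_mul_le_of_profiles` at degrees `3 + b ≥ 5`). -/
theorem sum_box_abs_secondDiff_ghostRem_le_of_letters {Aw K : ℝ} {b : ℕ} (hb : 2 ≤ b) (e e' u : Pt)
    (hSw : ∀ y : Pt, ∑ q ∈ box 4 N, |blockSum N (fun z => latticeGreen (N • u + q + e + e' - z) / 2) y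
        - blockSum N (fun z => latticeGreen (N • u + q + e - z) / 2) y
        - blockSum N (fun z => latticeGreen (N • u + q + e' - z) / 2) y + blockSum N (fun z => latticeGreen (N • u + q - z) / 2) y|
      ≤ Aw * (((supNorm (y - u) : ℝ) + 1) ^ 3)⁻¹)
    (hW : ∀ y x' : Pt, |Ws (d := 3) (N := N) y x'| ≤ K * ((N : ℝ) ^ 4)⁻¹ * (((supNorm (y - quo N x') : ℝ) + 1) ^ b)⁻¹) (x' : Pt) :
    ∑ q ∈ box 4 N, |ghostRem (d := 3) N (N • u + q + e + e') x' - ghostRem (d := 3) N (N • u + q + e) x'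
        - ghostRem (d := 3) N (N • u + q + e') x' + ghostRem (d := 3) N (N • u + q) x'|
      ≤ 162 * Aw * K * ((N : ℝ) ^ 4)⁻¹ := by
  -- the block columns and their second differences
  set S : Pt → Pt → ℝ := fun x y => blockSum N (fun z => latticeGreen (x - z) / 2) y with hS
  set DS : Pt → Pt → ℝ := fun q y => S (N • u + q + e + e') y - S (N • u + q + e) y - S (N • u + q + e') y + S (N • u + q) y with hDS
  have hs : ∀ p : Pt, Summable fun y => S p y * Ws (d := 3) (N := N) y x' :=
    fun p => summable_bdd_mul_Ws (fun y => abs_blockSum_free_le (by norm_num) p y) x'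
  -- each window term as ONE series
  have hD : ∀ q : Pt, ghostRem (d := 3) N (N • u + q + e + e') x' - ghostRem (d := 3) N (N • u + q + e) x'
      - ghostRem (d := 3) N (N • u + q + e') x' + ghostRem (d := 3) N (N • u + q) x' = ∑' y, DS q y * Ws (d := 3) (N := N) y x' := by
    intro q
    rw [ghostRem_eq_tsum (by norm_num) (N • u + q + e + e') x', ghostRem_eq_tsum (by norm_num) (N • u + q + e) x',
      ghostRem_eq_tsum (by norm_num) (N • u + q + e') x', ghostRem_eq_tsum (by norm_num) (N • u + q) x',
      ← (hs _).tsum_sub (hs _), ← ((hs _).sub (hs _)).tsum_sub (hs _), ← (((hs _).sub (hs _)).sub (hs _)).tsum_add (hs _)]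
    exact tsum_congr fun y => by simp only [hDS, hS]; ring
  -- the second differences of the columns are bounded, so `|DS q · Ws|` is summable
  have hBdd : ∀ q y, |DS q y| ≤ 4 * ((AffineAveraging.box (3 + 1) N).card * (latticeGreen (0 : AffineAveraging.Site (3 + 1)) / 2)) := by
    intro q y
    have h1 := abs_blockSum_free_le (N := N) (by norm_num : 2 ≤ 3) (N • u + q + e + e') y
    have h2 := abs_blockSum_free_le (N := N) (by norm_num : 2 ≤ 3) (N • u + q + e) y
    have h3 := abs_blockSum_free_le (N := N) (by norm_num : 2 ≤ 3) (N • u + q + e') y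
    have h4 := abs_blockSum_free_le (N := N) (by norm_num : 2 ≤ 3) (N • u + q) y
    simp only [hDS, hS]
    calc |blockSum N (fun z => latticeGreen (N • u + q + e + e' - z) / 2) y - blockSum N (fun z => latticeGreen (N • u + q + e - z) / 2) y
            - blockSum N (fun z => latticeGreen (N • u + q + e' - z) / 2) y + blockSum N (fun z => latticeGreen (N • u + q - z) / 2) y|
        ≤ |blockSum N (fun z => latticeGreen (N • u + q + e + e' - z) / 2) y| + |blockSum N (fun z => latticeGreen (N • u + q + e - z) / 2) y|
            + |blockSum N (fun z => latticeGreen (N • u + q + e' - z) / 2) y| + |blockSum N (fun z => latticeGreen (N • u + q - z) / 2) y| := by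
          refine (abs_add_le _ _).trans ?_
          refine add_le_add ((abs_sub _ _).trans (add_le_add ((abs_sub _ _)) le_rfl)) le_rfl
      _ ≤ _ := by linarith
  have habs : ∀ q : Pt, Summable fun y => |DS q y| * |Ws (d := 3) (N := N) y x'| := by
    intro q
    have h := (summable_bdd_mul_Ws (N := N) (hBdd q) x').abs
    simpa only [abs_mul] using h
  -- per position: `|Σ' DS·Ws| ≤ Σ' |DS|·|Ws|`
  have hq : ∀ q : Pt, |ghostRem (d := 3) N (N • u + q + e + e') x' - ghostRem (d := 3) N (N • u + q + e) x'
      - ghostRem (d := 3) N (N • u + q + e') x' + ghostRem (d := 3) N (N • u + q) x'| ≤ ∑' y, (|DS q y| * |Ws (d := 3) (N := N) y x'|) := by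
    intro q
    rw [hD q]
    have h := norm_tsum_le_tsum_norm (f := fun y => DS q y * Ws (d := 3) (N := N) y x') (by simpa only [Real.norm_eq_abs, abs_mul] using habs q)
    simpa only [Real.norm_eq_abs, abs_mul] using h
  -- Fubini for the finite window, then the two-profile sum
  have hSw' : ∀ y, |(∑ q ∈ box 4 N, |DS q y|)| ≤ Aw * (((supNorm (y - u) : ℝ) + 1) ^ 3)⁻¹ := by
    intro y
    rw [abs_of_nonneg (sum_nonneg fun _ _ => abs_nonneg _)]
    simpa only [hDS, hS] using hSw y
  have hW' : ∀ y, |(|Ws (d := 3) (N := N) y x'|)| ≤ K * ((N : ℝ) ^ 4)⁻¹ * (((supNorm (y - quo N x') : ℝ) + 1) ^ b)⁻¹ := by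
    intro y; rw [abs_abs]; exact hW y x'
  have hmain := abs_tsum_mul_le_of_profiles (S := fun y => ∑ q ∈ box 4 N, |DS q y|) (W := fun y => |Ws (d := 3) (N := N) y x'|)
    (p := 3) (q := b) (by omega) u (quo N x') hSw' hW'
  calc ∑ q ∈ box 4 N, |ghostRem (d := 3) N (N • u + q + e + e') x' - ghostRem (d := 3) N (N • u + q + e) x'
          - ghostRem (d := 3) N (N • u + q + e') x' + ghostRem (d := 3) N (N • u + q) x'|
      ≤ ∑ q ∈ box 4 N, ∑' y, (|DS q y| * |Ws (d := 3) (N := N) y x'|) := sum_le_sum fun q _ => hq q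
    _ = ∑' y, ∑ q ∈ box 4 N, (|DS q y| * |Ws (d := 3) (N := N) y x'|) := (Summable.tsum_finsetSum fun q _ => habs q).symm
    _ = ∑' y, ((∑ q ∈ box 4 N, |DS q y|) * |Ws (d := 3) (N := N) y x'|) := tsum_congr fun y => by rw [sum_mul]
    _ ≤ |∑' y, ((∑ q ∈ box 4 N, |DS q y|) * |Ws (d := 3) (N := N) y x'|)| := le_abs_self _
    _ ≤ 162 * Aw * (K * ((N : ℝ) ^ 4)⁻¹) := hmain.2
    _ = 162 * Aw * K * ((N : ℝ) ^ 4)⁻¹ := by ring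

/-! ## §4 Under (H-CINV) + the first-difference leg letter; and unconditionally -/

/-- [folklore] **(T2-win) UNDER (H-CINV) + (G1)**: the coarse inverse's letters (`hC`, `hCM`), the within-block oscillation letter (`hAosc`, from (G1) by
`ConstrainedGhostIRLetters.letterOsc`) and the first-difference leg letter in direction `μ` ⟹ for every `u x′`:
`Σ_{q∈box 4 N} |Δ_νΔ_μ ghostRem N (N•u+q, ·) x′| ≤ 162·(82944·C₁)·(1296·κ·a₂·N⁶ + 1)` (log-free; `= O(1)` at IR-4b's `κ = c₀N⁻⁶`). -/
theorem sum_box_abs_secondDiff_ghostRem_le_of_coarseInv (C : AffineAveraging.Site (3 + 1) → AffineAveraging.Site (3 + 1) → ℝ) {κ a₂ C₁ : ℝ}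
    (hN : 1 ≤ N) (hC : ∀ u v, |C u v| ≤ κ / ((supNorm (u - v) : ℝ) + 1) ^ 5)
    (hCM : ∀ u w, HasSum (fun v => C u v * ∑ b ∈ AffineAveraging.box (3 + 1) N,
      blockSum N (fun z => latticeGreen ((N : ℤ) • v + toSite b - z) / 2) w) (if u = w then 1 else 0))
    (hAosc : ∀ x y v : AffineAveraging.Site (3 + 1), quo N x = quo N y →
      |blockSum N (fun z => latticeGreen (x - z) / 2) v - blockSum N (fun z => latticeGreen (y - z) / 2) v|
        ≤ a₂ * (N : ℝ) ^ 2 / ((supNorm (quo N x - v) : ℝ) + 1) ^ 3)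
    (μ ν : Fin 4) (hG1 : ∀ z : Pt, |latticeGreen (z + Pi.single μ 1) / 2 - latticeGreen z / 2| ≤ C₁ / ((supNorm z : ℝ) + 1) ^ 3)
    (u x' : Pt) :
    ∑ q ∈ box 4 N, |ghostRem (d := 3) N (N • u + q + unitVec ν + unitVec μ) x' - ghostRem (d := 3) N (N • u + q + unitVec ν) x'
        - ghostRem (d := 3) N (N • u + q + unitVec μ) x' + ghostRem (d := 3) N (N • u + q) x'|
      ≤ 162 * (82944 * C₁) * (1296 * κ * a₂ * (N : ℝ) ^ 6 + 1) := by
  have hN0 : (0 : ℝ) < N := by exact_mod_cast hN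
  have hN4 : (0 : ℝ) < (N : ℝ) ^ 4 := by positivity
  -- the window letter of the UN-normalised columns: `N⁴ ×` §2
  have hSw : ∀ y : Pt, ∑ q ∈ box 4 N, |blockSum N (fun z => latticeGreen (N • u + q + unitVec ν + unitVec μ - z) / 2) y
        - blockSum N (fun z => latticeGreen (N • u + q + unitVec ν - z) / 2) y
        - blockSum N (fun z => latticeGreen (N • u + q + unitVec μ - z) / 2) y + blockSum N (fun z => latticeGreen (N • u + q - z) / 2) y|
      ≤ (82944 * C₁ * (N : ℝ) ^ 4) * (((supNorm (y - u) : ℝ) + 1) ^ 3)⁻¹ := by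
    intro y
    have h := sum_box_abs_blockAvg_fwdDiff₂_le_profile (P := fun z => latticeGreen z / 2) μ ν hG1 hN u y
    have e1 : (unitVec μ : Pt) = Pi.single μ 1 := rfl
    have e2 : (unitVec ν : Pt) = Pi.single ν 1 := rfl
    rw [e1, e2]
    have hscale : ∀ a b c d' : ℝ, |a - b - c + d'|
        = (N : ℝ) ^ 4 * |((N : ℝ) ^ 4)⁻¹ * a - ((N : ℝ) ^ 4)⁻¹ * b - ((N : ℝ) ^ 4)⁻¹ * c + ((N : ℝ) ^ 4)⁻¹ * d'| := by
      intro a b c d'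
      rw [← abs_of_pos hN4, ← abs_mul, abs_of_pos hN4]
      congr 1; field_simp
    rw [sum_congr rfl fun q _ => hscale _ _ _ _, ← mul_sum]
    calc (N : ℝ) ^ 4 * _ ≤ (N : ℝ) ^ 4 * (82944 * C₁ / ((supNorm (y - u) : ℝ) + 1) ^ 3) := mul_le_mul_of_nonneg_left h hN4.le
      _ = (82944 * C₁ * (N : ℝ) ^ 4) * (((supNorm (y - u) : ℝ) + 1) ^ 3)⁻¹ := by rw [div_eq_mul_inv]; ring
  have h := sum_box_abs_secondDiff_ghostRem_le_of_letters (N := N) (b := 3) (by norm_num) (unitVec ν) (unitVec μ) u hSw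
    (abs_Ws_le_of_coarseInv C hN hC hCM hAosc) x'
  refine h.trans (le_of_eq ?_)
  field_simp

/-- [folklore] **(T2-win) — UNCONDITIONALLY, LOG-FREE**: for ALL `N ≥ 1`, `μ ν` (the diagonal included), `u x′ : ℤ⁴`,
`Σ_{q ∈ box 4 N} |ghostRem N (N•u+q+e_ν+e_μ) x′ − ghostRem N (N•u+q+e_ν) x′ − ghostRem N (N•u+q+e_μ) x′ + ghostRem N (N•u+q) x′| ≤ K_win`,
`K_win = 162·(82944·C₁)·(1296·cC·(6912·104977·C₁) + 1)`, `C₁ = 8(2U+2c₄+Bgrad)` of `TwoPowerLegs.free`, `cC = (cInv 4 1 + 1)·e^δ·5!∕δ⁵`, `δ = deltaInv 4 1`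
— the `(2N+1)⁴` positions of the radius-`N` window around any coarse point carry a TOTAL second-difference mass `O(1)` (every block `B(u′) ⊂ N•u′ + box 4 N`):
R-FP-20's (T2-win), from leaf-06's IR-4b coarse inverse and gan24's PART 5∕6 BY NAME. -/
theorem sum_box_abs_secondDiff_ghostRem_le (hN : 1 ≤ N) (μ ν : Fin 4) (u x' : Pt) :
    ∑ q ∈ box 4 N, |ghostRem (d := 3) N (N • u + q + unitVec ν + unitVec μ) x' - ghostRem (d := 3) N (N • u + q + unitVec ν) x'
        - ghostRem (d := 3) N (N • u + q + unitVec μ) x' + ghostRem (d := 3) N (N • u + q) x'|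
      ≤ 162 * (82944 * (8 * (2 * free.U + 2 * c4 + free.Bgrad)))
          * (1296 * ((cInv 4 1 + 1) * (Real.exp (deltaInv 4 1) * (Nat.factorial 5) / deltaInv 4 1 ^ 5))
              * (6912 * 104977 * (8 * (2 * free.U + 2 * c4 + free.Bgrad))) + 1) := by
  have h := sum_box_abs_secondDiff_ghostRem_le_of_coarseInv (N := N) (fun u v => (((N : ℝ)) ^ (4 + 2))⁻¹ * actionKer (N - 1) 1 u v) hN
    (coarseInv_hC (N := N)) (fun u w => hasSum_coarseInv_mul_bracket' (d := 4) (by norm_num) N u w)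
    (fun a b v hab => letterOsc hN (fun i z => letterDiff_free i z) a b v hab) μ ν (fun z => letterDiff_free μ z) u x'
  refine h.trans (le_of_eq ?_)
  have h6 : (((N : ℝ)) ^ (4 + 2))⁻¹ * (N : ℝ) ^ 6 = 1 := by
    have hN0 : (0 : ℝ) < N := by exact_mod_cast hN
    rw [show 4 + 2 = 6 by norm_num]; field_simp
  have e : 1296 * ((cInv 4 1 + 1) * (((N : ℝ)) ^ (4 + 2))⁻¹ * (Real.exp (deltaInv 4 1) * (Nat.factorial 5) / deltaInv 4 1 ^ 5))
      * (6912 * 104977 * (8 * (2 * free.U + 2 * c4 + free.Bgrad))) * (N : ℝ) ^ 6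
      = 1296 * ((cInv 4 1 + 1) * (Real.exp (deltaInv 4 1) * (Nat.factorial 5) / deltaInv 4 1 ^ 5))
        * (6912 * 104977 * (8 * (2 * free.U + 2 * c4 + free.Bgrad))) := by
    calc _ = 1296 * ((cInv 4 1 + 1) * (Real.exp (deltaInv 4 1) * (Nat.factorial 5) / deltaInv 4 1 ^ 5))
          * (6912 * 104977 * (8 * (2 * free.U + 2 * c4 + free.Bgrad))) * ((((N : ℝ)) ^ (4 + 2))⁻¹ * (N : ℝ) ^ 6) := by ring
      _ = _ := by rw [h6, mul_one]
  rw [e]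

end Summit.QuantumFields.BalabanUV.Beta.FP.ConstrainedGhostIRWindow

end
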